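import Summits.BirchSwinnertonDyer.BirchSwinnertonDyer.Theorems.ClassRecordThreeCartanSupplySphericalLeaves
import HarnessLib

/-!
# One-sided multiplicity and the type cut — §2–§3 of the `doublecoset` certificate for crux 24801 `CartanOnePlaceDegreeLawAtThree`

Lift-only port (cell bsd-stepL, SUMMON key `k5-lift1`, director-bsd (734)(1) CONCUR 2026-08-31) of §2–§3 (source lines 674–956) of the crux-ideate workfile
`Summits/BirchSwinnertonDyer/BirchSwinnertonDyer/Cruxes/CartanOnePlaceDegreeLawAtThree/Lines/doublecoset.lean` (lineage `cruxidea-stmt-BirchSwinnertonDyer-24801-1`, generation 22,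
commit 721e9ccbdf4b, sha256-16 d3adee7328f6a76c, 2876 l.; farm rc 0, sorries 4 = its §4 stubs, none of which is lifted; referee landing record `VERDICT-DOUBLECOSET-G22-g88.md`).
Declarations, statements and proofs below are BYTE-IDENTICAL to the source; the only edits are the namespace (`…Cruxes.CartanOnePlaceDegreeLawAtThree.Doublecoset` ↦
`…Theorems.CartanDoubleCoset`, shared by the nine `ClassRecordThreeCartanSupply*` modules), the imports ∕ `open`s each module needs, and one-line docstrings added where the source
had none. Nothing is re-stated, weakened or re-proved.

CONTENT. §2 ONE-SIDED MULTIPLICITY (generation 18, real proofs): Maschke components + the commutator trick (`fixed_components`) + (SPH) summand-wise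
(`exists_splitFixed_in_spanG`) give the lever `mem_spanG_of_rankOne` and `irreducible_spanG_of_rankOne`; hence (L1S) ∧ (SPH) ⟹ (IRR)♮ (`coverIsotypicIrreducible_of`),
(L1S) ⟹ (IRR)♮ outright (`coverIsotypicIrreducible_of'`, (SPH) being the theorem `sphericalTransfer`), (L1S) ⟹ (M1S♮) (`splitFixedLine_of_rankOne`), and (IRR)♮ ⟸ (ISO)♮
(`coverIsotypicIrreducible_of_iso`). §3 THE TYPE CUT (generation 14): (IRR)♮ ∧ (BCV) ∧ (FGT-PS) ∧ (VAN) ∧ (FGT-C) ⟹ (ISO)♮ `CartanNatural.CoverIsotypicComponent`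
(`coverIsotypicComponent_of`), and the node's cuts `coverIsotypicComponent_of_lines` ∕ `coverIsotypicComponent_of_lines'`.

HONEST: a `--supports stmt-BirchSwinnertonDyer-24801` helper module; it proves NOTHING about NUM ∕ NUM♮ (items 24801 ∕ 32276) or crux 19109 for any curve — the leaves (MO1)
`SplitLevelMultiplicityOne`, (BCV) `BorelCubicEigenDocking`, (VAN) `NonsplitTorusCubicVanishing`, (DS) ∧ (JLᶜ) stay OPEN; registry `Lines/petarea.lean` rev 8 untouched; BSD is proved for no curve.
-/

set_option linter.dupNamespace false  -- `Summit.BirchSwinnertonDyer.BirchSwinnertonDyer.…` (summit = problem), as every file of this directory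
set_option autoImplicit false

noncomputable section

open scoped Classical MatrixGroups
open Matrix

namespace Summit.BirchSwinnertonDyer.BirchSwinnertonDyer.Theorems.CartanDoubleCoset

open Summit.BirchSwinnertonDyer.BirchSwinnertonDyer.Theorems
open Summit.BirchSwinnertonDyer.BirchSwinnertonDyer.Theorems.CartanDegree (HasRatEigenvalue)
open Summit.BirchSwinnertonDyer.BirchSwinnertonDyer.Theorems.CartanTorusCubeCut (torusSubgroup mem_torusSubgroup lin linGL linGL_coe lin_comm torusSubgroup_isCyclic card_torusSubgroup)
open Summit.BirchSwinnertonDyer.BirchSwinnertonDyer.Theorems.CartanCover (splitGen mem_splitTorus_iff)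
open Summit.BirchSwinnertonDyer.BirchSwinnertonDyer.Theorems.CartanCover.Charext.InertHecke (upperUnip lowerUnip coe_upperUnip coe_lowerUnip upperUnip_mul upperUnip_zero exists_unip_factorization)
open scoped Pointwise ModularForm NumberField
open Module UpperHalfPlane
open Literature.NumberTheory.Automorphic WeierstrassCurve Literature.NumberTheory.EllipticCurves Literature.NumberTheory.EllipticCurves.ModularForms
open Literature.NumberTheory.EllipticCurves.Rank1Residual Summit.BirchSwinnertonDyer.Rank1Residual Literature.NumberTheory.GaloisRepresentations NumberField IsDedekindDomain
open Summit.BirchSwinnertonDyer.BirchSwinnertonDyer.Theorems.CartanCover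
open Summit.BirchSwinnertonDyer.BirchSwinnertonDyer.Theorems.CartanCover.CMRank
open Summit.BirchSwinnertonDyer.BirchSwinnertonDyer.Theorems.CartanTorusCubeCut
open Summit.BirchSwinnertonDyer.BirchSwinnertonDyer.Theorems.CartanDegree (cubicNewvectorChar HasRatEigenvalue)

/-! ## §2 PROVED (verbatim `Lines/onesided.lean` §2, generation 18): ONE-SIDED MULTIPLICITY — (L1S) ∧ (SPH) ⟹ (IRR)♮ (Maschke components + summand-wise spherical transfer), and (L1S) ⟹ (M1S♮); NEW: (L1S) ⟹ (IRR)♮ outright (`coverIsotypicIrreducible_of'`) -/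

section OneSided

variable {D M : ℕ} {C : Finset ℕ} {X : CartanLevelCurveData D M C} {q : ℕ} [Fact q.Prime]

/-- Irreducibility of a `G`-stable `𝒱 ≤ IndCuspForm` (no proper non-zero `G`-stable submodule of `IndCuspForm` below it) transfers to the representation `ρ` on the subtype `𝒱`. -/
theorem irreducible_subtype (R : CoverReduction X q) {𝒱 : Submodule ℂ R.IndCuspForm} (ρ : Representation ℂ (GL (Fin 2) (ZMod q)) 𝒱)
    (hρ : ∀ (g : GL (Fin 2) (ZMod q)) (F : 𝒱), ((ρ g F : 𝒱) : R.IndCuspForm) = R.indRep g (F : R.IndCuspForm))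
    (hirr : ∀ 𝒲 : Submodule ℂ R.IndCuspForm, 𝒲 ≤ 𝒱 → (∀ g : GL (Fin 2) (ZMod q), ∀ F ∈ 𝒲, R.indRep g F ∈ 𝒲) → 𝒲 = ⊥ ∨ 𝒲 = 𝒱) :
    ∀ W' : Submodule ℂ 𝒱, (∀ g : GL (Fin 2) (ZMod q), ∀ w ∈ W', ρ g w ∈ W') → W' = ⊥ ∨ W' = ⊤ := by
  intro W' hW'
  have h1 : W'.map 𝒱.subtype ≤ 𝒱 := Submodule.map_subtype_le 𝒱 W'
  have h2 : ∀ g : GL (Fin 2) (ZMod q), ∀ F ∈ W'.map 𝒱.subtype, R.indRep g F ∈ W'.map 𝒱.subtype := by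
    rintro g _ ⟨w, hw, rfl⟩
    exact ⟨ρ g w, hW' g w hw, hρ g w⟩
  rcases hirr _ h1 h2 with h | h
  · left
    have h' : W'.map 𝒱.subtype = (⊥ : Submodule ℂ 𝒱).map 𝒱.subtype := by rw [h, Submodule.map_bot]
    exact Submodule.map_injective_of_injective 𝒱.injective_subtype h'
  · right
    have h' : W'.map 𝒱.subtype = (⊤ : Submodule ℂ 𝒱).map 𝒱.subtype := by rw [h, Submodule.map_subtype_top]
    exact Submodule.map_injective_of_injective 𝒱.injective_subtype h'

/-- `ℂ[G]·u` is finite-dimensional (`G` is finite) (verbatim `Lines/borelpin.lean`). -/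
theorem finite_spanG (R : CoverReduction X q) (u : R.IndCuspForm) : Module.Finite ℂ (R.spanG u) :=
  Module.Finite.span_of_finite ℂ (Set.finite_range _)

/-- The restriction of `indRep` to the `G`-span `ℂ[G]·u` (a `Subrepresentation`), as a representation on the subtype; it agrees with `indRep` by `rfl`. -/
def spanRep (R : CoverReduction X q) (u : R.IndCuspForm) : Representation ℂ (GL (Fin 2) (ZMod q)) (R.spanG u) :=
  (⟨R.spanG u, fun g _ hv => R.indRep_mem_spanG u g hv⟩ : Subrepresentation R.indRep).toRepresentation

/-- `spanRep` agrees with `indRep` on the underlying vectors (`rfl`). -/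
theorem spanRep_apply (R : CoverReduction X q) (u : R.IndCuspForm) (g : GL (Fin 2) (ZMod q)) (F : R.spanG u) :
    ((spanRep R u g F : R.spanG u) : R.IndCuspForm) = R.indRep g (F : R.IndCuspForm) := rfl


/-- `ℂ[G]·y ≤ M` whenever `y ∈ M` and `M` is `G`-stable. -/
theorem spanG_le_of_mem (R : CoverReduction X q) {𝓜 : Submodule ℂ R.IndCuspForm}
    (hM : ∀ g : GL (Fin 2) (ZMod q), ∀ F ∈ 𝓜, R.indRep g F ∈ 𝓜) {y : R.IndCuspForm} (hy : y ∈ 𝓜) : R.spanG y ≤ 𝓜 := by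
  refine Submodule.span_le.mpr ?_
  rintro _ ⟨g, rfl⟩
  exact hM g y hy

/-- The sum of two `G`-spans is `G`-stable. -/
theorem indRep_mem_sup_spanG (R : CoverReduction X q) (u x : R.IndCuspForm) (g : GL (Fin 2) (ZMod q)) {F : R.IndCuspForm}
    (hF : F ∈ R.spanG u ⊔ R.spanG x) : R.indRep g F ∈ R.spanG u ⊔ R.spanG x := by
  obtain ⟨a, ha, b, hb, rfl⟩ := Submodule.mem_sup.mp hF
  rw [map_add]
  exact Submodule.add_mem _ (Submodule.mem_sup_left (R.indRep_mem_spanG u g ha)) (Submodule.mem_sup_right (R.indRep_mem_spanG x g hb))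

/-- **THE COMMUTATOR TRICK.** If `u₁ + u₂` is fixed by `t`, with `u₁ ∈ σ`, `u₂ ∈ σ'`, both `G`-stable and `σ ⊓ σ' = ⊥`, then `t` fixes `u₁` and `u₂`
(`t·u₁ − u₁ = u₂ − t·u₂ ∈ σ ⊓ σ'`). -/
theorem fixed_components (R : CoverReduction X q) {σ σ' : Submodule ℂ R.IndCuspForm}
    (hσ : ∀ g : GL (Fin 2) (ZMod q), ∀ F ∈ σ, R.indRep g F ∈ σ) (hσ' : ∀ g : GL (Fin 2) (ZMod q), ∀ F ∈ σ', R.indRep g F ∈ σ')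
    (hinf : σ ⊓ σ' = ⊥) {u₁ u₂ : R.IndCuspForm} (hu₁ : u₁ ∈ σ) (hu₂ : u₂ ∈ σ') {t : GL (Fin 2) (ZMod q)}
    (ht : R.indRep t (u₁ + u₂) = u₁ + u₂) : R.indRep t u₁ = u₁ ∧ R.indRep t u₂ = u₂ := by
  rw [map_add] at ht
  have h1 : R.indRep t u₁ - u₁ ∈ σ := Submodule.sub_mem _ (hσ t u₁ hu₁) hu₁
  have h2 : u₂ - R.indRep t u₂ ∈ σ' := Submodule.sub_mem _ hu₂ (hσ' t u₂ hu₂)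
  have he : R.indRep t u₁ - u₁ = u₂ - R.indRep t u₂ := by
    rw [sub_eq_sub_iff_add_eq_add, ht]
    exact add_comm u₁ u₂
  have hmem : R.indRep t u₁ - u₁ ∈ σ ⊓ σ' := ⟨h1, he ▸ h2⟩
  rw [hinf, Submodule.mem_bot, sub_eq_zero] at hmem
  refine ⟨hmem, ?_⟩
  have h3 : u₂ - R.indRep t u₂ = 0 := by rw [← he, hmem, sub_self]
  exact (sub_eq_zero.mp h3).symm

/-- **(SPH) SUMMAND-WISE**: a non-zero `T_η`-fixed `y` has a non-zero DIAGONAL-torus-fixed vector in its own `G`-span `ℂ[G]·y` (apply (SPH) to the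
finite-dimensional sub-representation `spanRep R y`). -/
theorem exists_splitFixed_in_spanG (hSPH : SphericalTransfer) (R : CoverReduction X q) {y : R.IndCuspForm} (hy0 : y ≠ 0)
    (hyT : ∀ t ∈ CartanTorusCubeCut.torusSubgroup R.η, R.indRep t y = y) :
    ∃ v ∈ R.spanG y, v ≠ 0 ∧ ∀ t ∈ CartanTorusCubeCut.torusSubgroup (splitGen q), R.indRep t v = v := by
  haveI : Module.Finite ℂ (R.spanG y) := finite_spanG R y
  obtain ⟨v, hv0, hvT⟩ := hSPH q R.η R.η_irred (R.spanG y) (spanRep R y)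
    ⟨⟨y, R.self_mem_spanG y⟩, fun h => hy0 (Submodule.coe_eq_zero.mpr h), fun t ht => Subtype.ext (by rw [spanRep_apply]; exact hyT t ht)⟩
  exact ⟨v, v.2, fun h => hv0 (Submodule.coe_eq_zero.mp h), fun t ht => by
    rw [← spanRep_apply]; exact congrArg Subtype.val (hvT t ht)⟩

/-- **ONE-SIDED MEMBERSHIP (the lever, sorry-free).** `u ≠ 0` is `T_η`-fixed; `x` is fixed by `T_η` OR by the diagonal torus `T_s`; if any two `T_s`-fixed
vectors of `M := ℂ[G]·u + ℂ[G]·x` are dependent (ONE diagonal-fixed line at most) then `x ∈ ℂ[G]·u`. Proof: Maschke complement `σ'` of `ℂ[G]·u` in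
`IndCuspForm`; `x = x₁ + x₂`, `x₂ ∈ σ' ∩ M` is fixed by the torus fixing `x` (commutator trick); if `x₂ ≠ 0`, (SPH) on `ℂ[G]·x₂` (or `x₂` itself in the
diagonal case) gives a non-zero `T_s`-fixed `v₂ ∈ ℂ[G]·x₂ ⊆ σ' ∩ M`, (SPH) on `ℂ[G]·u` gives a non-zero `T_s`-fixed `v₁ ∈ ℂ[G]·u ⊆ M`; the hypothesis makes
`v₂ = c • v₁ ∈ ℂ[G]·u ⊓ σ' = ⊥`, contradiction; so `x₂ = 0`. This is the dimension INEQUALITY `dim M^{T_η} ≤ dim M^{T_s}` of de Smit–Edixhoven made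
summand-wise: every non-zero summand met costs one diagonal-fixed line, and there is only one. [cite: deSmitEdixhoven2000, Thm. 2]
[cite: SerreLinearRepresentations1977, §1.3 Thm. 1] -/
theorem mem_spanG_of_rankOne (hSPH : SphericalTransfer) (R : CoverReduction X q) {u x : R.IndCuspForm} (hu0 : u ≠ 0)
    (huT : ∀ t ∈ CartanTorusCubeCut.torusSubgroup R.η, R.indRep t u = u)
    (hxT : (∀ t ∈ CartanTorusCubeCut.torusSubgroup R.η, R.indRep t x = x) ∨
      (∀ t ∈ CartanTorusCubeCut.torusSubgroup (splitGen q), R.indRep t x = x))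
    (hline : ∀ w₁ ∈ R.spanG u ⊔ R.spanG x, ∀ w₂ ∈ R.spanG u ⊔ R.spanG x,
      (∀ t ∈ CartanTorusCubeCut.torusSubgroup (splitGen q), R.indRep t w₁ = w₁) →
      (∀ t ∈ CartanTorusCubeCut.torusSubgroup (splitGen q), R.indRep t w₂ = w₂) → w₁ ≠ 0 → ∃ c : ℂ, w₂ = c • w₁) :
    x ∈ R.spanG u := by
  haveI : NeZero ((Nat.card (GL (Fin 2) (ZMod q)) : ℂ)) := ⟨Nat.cast_ne_zero.mpr Nat.card_pos.ne'⟩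
  let σ : Subrepresentation R.indRep := ⟨R.spanG u, fun g v hv => R.indRep_mem_spanG u g hv⟩
  obtain ⟨σ', hc⟩ := exists_isCompl σ
  have hinf : R.spanG u ⊓ σ'.toSubmodule = ⊥ := congrArg Subrepresentation.toSubmodule hc.inf_eq_bot
  have hsup : R.spanG u ⊔ σ'.toSubmodule = ⊤ := congrArg Subrepresentation.toSubmodule hc.sup_eq_top
  have hx : x ∈ R.spanG u ⊔ σ'.toSubmodule := by rw [hsup]; exact Submodule.mem_top
  obtain ⟨x₁, hx₁, x₂, hx₂, hsum⟩ := Submodule.mem_sup.mp hx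
  have hσst : ∀ g : GL (Fin 2) (ZMod q), ∀ F ∈ R.spanG u, R.indRep g F ∈ R.spanG u := fun g F hF => R.indRep_mem_spanG u g hF
  have hσ'st : ∀ g : GL (Fin 2) (ZMod q), ∀ F ∈ σ'.toSubmodule, R.indRep g F ∈ σ'.toSubmodule := fun g F hF => σ'.apply_mem_toSubmodule g hF
  have hx₂M : x₂ ∈ R.spanG u ⊔ R.spanG x := by
    have e : x₂ = x - x₁ := by rw [← hsum, add_sub_cancel_left]
    rw [e]
    exact Submodule.sub_mem _ (Submodule.mem_sup_right (R.self_mem_spanG x)) (Submodule.mem_sup_left hx₁)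
  by_contra hxu
  have hx₂0 : x₂ ≠ 0 := by
    intro h
    apply hxu
    rw [← hsum, h, add_zero]
    exact hx₁
  -- a non-zero DIAGONAL-torus-fixed vector inside `ℂ[G]·x₂ ⊆ σ' ∩ M`
  have hv₂ : ∃ v ∈ R.spanG x₂, v ≠ 0 ∧ ∀ t ∈ CartanTorusCubeCut.torusSubgroup (splitGen q), R.indRep t v = v := by
    rcases hxT with hT | hT
    · exact exists_splitFixed_in_spanG hSPH R hx₂0 fun t ht =>
        (fixed_components R hσst hσ'st hinf hx₁ hx₂ (by rw [hsum]; exact hT t ht)).2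
    · exact ⟨x₂, R.self_mem_spanG x₂, hx₂0, fun t ht =>
        (fixed_components R hσst hσ'st hinf hx₁ hx₂ (by rw [hsum]; exact hT t ht)).2⟩
  obtain ⟨v₂, hv₂sp, hv₂0, hv₂T⟩ := hv₂
  -- a non-zero DIAGONAL-torus-fixed vector inside `ℂ[G]·u ⊆ M`
  obtain ⟨v₁, hv₁sp, hv₁0, hv₁T⟩ := exists_splitFixed_in_spanG hSPH R hu0 huT
  have hv₁M : v₁ ∈ R.spanG u ⊔ R.spanG x := Submodule.mem_sup_left hv₁sp
  have hv₂M : v₂ ∈ R.spanG u ⊔ R.spanG x := spanG_le_of_mem R (fun g F hF => indRep_mem_sup_spanG R u x g hF) hx₂M hv₂sp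
  obtain ⟨c, hcv⟩ := hline v₁ hv₁M v₂ hv₂M hv₁T hv₂T hv₁0
  have hv₂σ : v₂ ∈ R.spanG u := by rw [hcv]; exact Submodule.smul_mem _ c hv₁sp
  have hv₂σ' : v₂ ∈ σ'.toSubmodule := spanG_le_of_mem R hσ'st hx₂ hv₂sp
  have hmem : v₂ ∈ R.spanG u ⊓ σ'.toSubmodule := ⟨hv₂σ, hv₂σ'⟩
  rw [hinf, Submodule.mem_bot] at hmem
  exact hv₂0 hmem

/-- **ONE-SIDED IRREDUCIBILITY (sorry-free).** `u` `T_η`-fixed (for `u = 0` both alternatives hold trivially); if any two DIAGONAL-torus-fixed vectors of `ℂ[G]·u` are dependent then `ℂ[G]·u` is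
IRREDUCIBLE (every `G`-stable submodule of `IndCuspForm` below it is `⊥` or all of it). Proof: Maschke complement `σ'` of `𝒲`; `u = u₁ + u₂` with BOTH
components `T_η`-fixed; if both are non-zero, (SPH) on `ℂ[G]·u₁ ⊆ 𝒲` and on `ℂ[G]·u₂ ⊆ σ' ∩ ℂ[G]·u` gives two non-zero `T_s`-fixed vectors, dependent by
hypothesis, hence one lies in `𝒲 ⊓ σ' = ⊥` — contradiction; `u₁ = 0` ⟹ `ℂ[G]·u ≤ σ'` ⟹ `𝒲 = ⊥`; `u₂ = 0` ⟹ `u ∈ 𝒲` ⟹ `𝒲 = ℂ[G]·u`. No multiplicity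
statement for the NON-SPLIT torus is used (contrast `Lines/spherical.lean` `irreducible_spanG_of_fixedLine`, whose hypothesis is the `T_η`-fixed LINE). -/
theorem irreducible_spanG_of_rankOne (hSPH : SphericalTransfer) (R : CoverReduction X q) {u : R.IndCuspForm}
    (huT : ∀ t ∈ CartanTorusCubeCut.torusSubgroup R.η, R.indRep t u = u)
    (hline : ∀ w₁ ∈ R.spanG u, ∀ w₂ ∈ R.spanG u,
      (∀ t ∈ CartanTorusCubeCut.torusSubgroup (splitGen q), R.indRep t w₁ = w₁) →
      (∀ t ∈ CartanTorusCubeCut.torusSubgroup (splitGen q), R.indRep t w₂ = w₂) → w₁ ≠ 0 → ∃ c : ℂ, w₂ = c • w₁) :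
    ∀ 𝒲 : Submodule ℂ R.IndCuspForm, 𝒲 ≤ R.spanG u → (∀ g : GL (Fin 2) (ZMod q), ∀ F ∈ 𝒲, R.indRep g F ∈ 𝒲) → 𝒲 = ⊥ ∨ 𝒲 = R.spanG u := by
  intro 𝒲 hle hst
  haveI : NeZero ((Nat.card (GL (Fin 2) (ZMod q)) : ℂ)) := ⟨Nat.cast_ne_zero.mpr Nat.card_pos.ne'⟩
  let σ : Subrepresentation R.indRep := ⟨𝒲, fun g v hv => hst g v hv⟩
  obtain ⟨σ', hc⟩ := exists_isCompl σ
  have hinf : 𝒲 ⊓ σ'.toSubmodule = ⊥ := congrArg Subrepresentation.toSubmodule hc.inf_eq_bot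
  have hsup : 𝒲 ⊔ σ'.toSubmodule = ⊤ := congrArg Subrepresentation.toSubmodule hc.sup_eq_top
  have hu : u ∈ 𝒲 ⊔ σ'.toSubmodule := by rw [hsup]; exact Submodule.mem_top
  obtain ⟨u₁, hu₁, u₂, hu₂, hsum⟩ := Submodule.mem_sup.mp hu
  have hσ'st : ∀ g : GL (Fin 2) (ZMod q), ∀ F ∈ σ'.toSubmodule, R.indRep g F ∈ σ'.toSubmodule := fun g F hF => σ'.apply_mem_toSubmodule g hF
  have hfix : ∀ t ∈ CartanTorusCubeCut.torusSubgroup R.η, R.indRep t u₁ = u₁ ∧ R.indRep t u₂ = u₂ := fun t ht =>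
    fixed_components R hst hσ'st hinf hu₁ hu₂ (by rw [hsum]; exact huT t ht)
  by_cases h1 : u₁ = 0
  · left
    have hu2 : u ∈ σ'.toSubmodule := by rw [← hsum, h1, zero_add]; exact hu₂
    have hspan : R.spanG u ≤ σ'.toSubmodule := spanG_le_of_mem R hσ'st hu2
    refine (Submodule.eq_bot_iff _).mpr fun x hx => ?_
    have hx' : x ∈ 𝒲 ⊓ σ'.toSubmodule := ⟨hx, hspan (hle hx)⟩
    rwa [hinf, Submodule.mem_bot] at hx'
  by_cases h2 : u₂ = 0
  · right
    have huW : u ∈ 𝒲 := by rw [← hsum, h2, add_zero]; exact hu₁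
    exact le_antisymm hle (spanG_le_of_mem R hst huW)
  exfalso
  obtain ⟨v₁, hv₁sp, hv₁0, hv₁T⟩ := exists_splitFixed_in_spanG hSPH R h1 fun t ht => (hfix t ht).1
  obtain ⟨v₂, hv₂sp, hv₂0, hv₂T⟩ := exists_splitFixed_in_spanG hSPH R h2 fun t ht => (hfix t ht).2
  have hu₂span : u₂ ∈ R.spanG u := by
    have e : u₂ = u - u₁ := by rw [← hsum, add_sub_cancel_left]
    rw [e]
    exact Submodule.sub_mem _ (R.self_mem_spanG u) (hle hu₁)
  have hv₁W : v₁ ∈ 𝒲 := spanG_le_of_mem R hst hu₁ hv₁sp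
  have hv₂M : v₂ ∈ R.spanG u := spanG_le_of_mem R (fun g F hF => R.indRep_mem_spanG u g hF) hu₂span hv₂sp
  obtain ⟨c, hcv⟩ := hline v₁ (hle hv₁W) v₂ hv₂M hv₁T hv₂T hv₁0
  have hv₂W : v₂ ∈ 𝒲 := by rw [hcv]; exact Submodule.smul_mem _ c hv₁W
  have hv₂σ' : v₂ ∈ σ'.toSubmodule := spanG_le_of_mem R hσ'st hu₂ hv₂sp
  have hmem : v₂ ∈ 𝒲 ⊓ σ'.toSubmodule := ⟨hv₂W, hv₂σ'⟩
  rw [hinf, Submodule.mem_bot] at hmem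
  exact hv₂0 hmem

end OneSided

/-- **(IRR)♮ is WEAKER than (ISO)♮** (delete the trace clause; verbatim `Lines/borelpin.lean`). -/
theorem coverIsotypicIrreducible_of_iso (hISO : CartanNatural.CoverIsotypicComponent) : CoverIsotypicIrreducible := by
  intro V _ _ hS N D M C q _ X W₁ _ Q hq R hN hDMC hq3 hq3N hc hQ
  obtain ⟨𝒱, ρ, hρ, hirr, -, hNS, hSp⟩ := hISO V hS N D M C q X W₁ Q hq R hN hDMC hq3 hq3N hc hQ
  exact ⟨𝒱, ρ, hρ, hirr, hNS, hSp⟩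

/-- **THE NEW CUT: (L1S) ∧ (SPH) ⟹ (IRR)♮** (real proof). `𝒱 := ℂ[G]·u_C`, `ρ :=` the restriction of `indRep` (`spanRep`, agreement `rfl`); irreducible by
`irreducible_spanG_of_rankOne` with (L1S)(a) at `F = Q.form` (`ℂ[G]·u_C + ℂ[G]·u_C = ℂ[G]·u_C`); (NS) by `mem_spanG_of_rankOne` with `x = dockNonsplit F`
(`T_η`-fixed: `indRep_dockNonsplit_of_mem_torus`) and (L1S)(a); (S) by `mem_spanG_of_rankOne` with `x = dockTorus T_s F` (`T_s`-fixed: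
`indRep_dockTorus_of_mem`) and (L1S)(b). NO non-split multiplicity-one input. -/
theorem coverIsotypicIrreducible_of (hL1S : SplitFixedRankOne) (hSPH : SphericalTransfer) : CoverIsotypicIrreducible := by
  intro V _ _ hS N D M C q _ X W₁ _ Q hq R hN hDMC hq3 hq3N hc hQ
  obtain ⟨hNSline, hSline⟩ := hL1S V hS N D M C q X W₁ Q hq R hN hDMC hq3 hq3N hc hQ
  have huC0 : R.dockNonsplit hq Q.form ≠ 0 := dockNonsplit_form_ne_zero Q hq R
  have huCT : ∀ t ∈ CartanTorusCubeCut.torusSubgroup R.η, R.indRep t (R.dockNonsplit hq Q.form) = R.dockNonsplit hq Q.form :=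
    fun t ht => R.indRep_dockNonsplit_of_mem_torus hq Q.form ht
  have hVW : V.LFunction = W₁.LFunction := LFunction_eq_of_isIsogenous_holds V W₁ hQ.1
  have hline0 := hNSline Q.form fun ℓ hℓ hnd => by rw [hVW]; exact Q.hecke_eq ℓ hℓ hnd
  have hirr := irreducible_spanG_of_rankOne hSPH R huCT fun w₁ hw₁ w₂ hw₂ =>
    hline0 w₁ (Submodule.mem_sup_left hw₁) w₂ (Submodule.mem_sup_left hw₂)
  refine ⟨R.spanG (R.dockNonsplit hq Q.form), spanRep R (R.dockNonsplit hq Q.form), spanRep_apply R _, hirr, ?_, ?_⟩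
  · intro F hF
    exact mem_spanG_of_rankOne hSPH R huC0 huCT (Or.inl fun t ht => R.indRep_dockNonsplit_of_mem_torus hq F ht) (hNSline F hF)
  · intro Os hOs HOs F hF
    exact mem_spanG_of_rankOne hSPH R huC0 huCT (Or.inr fun t ht => R.indRep_dockTorus_of_mem _ F ht) (hSline Os hOs HOs F hF)

/-- **NEW CUT OF THIS NODE: (L1S) ALONE ⟹ (IRR)♮** — (SPH) is supplied by the theorem `sphericalTransfer` of §A (real proof, no sorry). -/
theorem coverIsotypicIrreducible_of' (hL1S : SplitFixedRankOne) : CoverIsotypicIrreducible :=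
  coverIsotypicIrreducible_of hL1S sphericalTransfer

/-- **(L1S) ⟹ (M1S♮)** (generation 17's split leaf is implied; real proof): a split docking and `w` are two diagonal-fixed vectors of `ℂ[G]·u_C + ℂ[G]·dockTorus F`. -/
theorem splitFixedLine_of_rankOne (hL1S : SplitFixedRankOne) : SplitFixedLine := by
  intro V _ _ hS N D M C q _ X W₁ _ Q hq R hN hDMC hq3 hq3N hc hQ w hw hw0 hwT Os hOs HOs F hF
  obtain ⟨-, hSline⟩ := hL1S V hS N D M C q X W₁ Q hq R hN hDMC hq3 hq3N hc hQ
  exact hSline Os hOs HOs F hF w (Submodule.mem_sup_left hw) _ (Submodule.mem_sup_right (R.self_mem_spanG _)) hwT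
    (fun t ht => R.indRep_dockTorus_of_mem _ F ht) hw0

/-! ## §3 PROVED (verbatim `Lines/borelpin.lean` §2 ∕ `Lines/spherical.lean` §3): THE TYPE CUT (IRR)♮ ∧ (BCV) ∧ (FGT-PS) ∧ (VAN) ∧ (FGT-C) ⟹ (ISO)♮,
and the node's full cut -/

/-- A prime `q ≠ 3` is `≡ 1` or `≡ 2 (mod 3)`. -/
theorem mod_three_of_prime_ne_three {q : ℕ} [Fact q.Prime] (hq3 : q ≠ 3) : q % 3 = 1 ∨ q % 3 = 2 := by
  have hp : q.Prime := Fact.out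
  have h0 : q % 3 ≠ 0 := by
    intro h
    rcases hp.eq_one_or_self_of_dvd 3 (Nat.dvd_of_mod_eq_zero h) with h | h
    · exact absurd h (by norm_num)
    · exact hq3 h.symm
  have := Nat.mod_lt q (show 0 < 3 by norm_num)
  omega

/-- **THE TYPE CUT (generation 14, verbatim): (IRR)♮ ∧ (BCV) ∧ (FGT-PS) ∧ (VAN) ∧ (FGT-C) ⟹ (ISO)♮** `CartanNatural.CoverIsotypicComponent`. -/
theorem coverIsotypicComponent_of (hIRR : CoverIsotypicIrreducible) (hBCV : BorelCubicEigenDocking) (hPS : CubicPrincipalSeriesCharacter)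
    (hVAN : NonsplitTorusCubicVanishing) (hCU : CubicCuspidalCharacter) : CartanNatural.CoverIsotypicComponent := by
  intro V _ _ hS N D M C q _ X W₁ _ Q hq R hN hDMC hq3 hq3N hc hQ
  obtain ⟨𝒱, ρ, hρ, hirr, hNS, hSp⟩ := hIRR V hS N D M C q X W₁ Q hq R hN hDMC hq3 hq3N hc hQ
  have hstab : ∀ g : GL (Fin 2) (ZMod q), ∀ F ∈ 𝒱, R.indRep g F ∈ 𝒱 := fun g F hF => by
    rw [← hρ g ⟨F, hF⟩]; exact (ρ g ⟨F, hF⟩).2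
  have hVW : V.LFunction = W₁.LFunction := LFunction_eq_of_isIsogenous_holds V W₁ hQ.1
  have huC : R.dockNonsplit hq Q.form ∈ 𝒱 := hNS Q.form fun ℓ hℓ hnd => by rw [hVW]; exact Q.hecke_eq ℓ hℓ hnd
  have heq : R.spanG (R.dockNonsplit hq Q.form) = 𝒱 :=
    eq_spanG_of_irreducible_of_mem R (dockNonsplit_form_ne_zero Q hq R) hstab hirr huC
  subst heq
  haveI : Module.Finite ℂ (R.spanG (R.dockNonsplit hq Q.form)) := finite_spanG R _
  have hirrW := irreducible_subtype R ρ hρ hirr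
  refine ⟨R.spanG (R.dockNonsplit hq Q.form), ρ, hρ, hirr, ?_, hNS, hSp⟩
  rcases mod_three_of_prime_ne_three hq3 with h1 | h2
  · -- principal-series regime: the cubic-Borel eigenvector docks, Frobenius reciprocity pins the type
    obtain ⟨lam, F, hFspan, hF0, hlam, heig⟩ := hBCV V hS N D M C q X W₁ Q hq R hN hDMC hq3 hq3N hc hQ h1
    have hv0 : (⟨F, hFspan⟩ : R.spanG (R.dockNonsplit hq Q.form)) ≠ 0 := fun h => hF0 (Submodule.coe_eq_zero.mpr h)
    exact hPS q h1 (R.spanG (R.dockNonsplit hq Q.form)) ρ hirrW lam ⟨F, hFspan⟩ hv0 hlam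
      (fun b hb => Subtype.ext (by rw [hρ, Submodule.coe_smul]; exact heig b hb))
  · -- cuspidal regime: `u_C` is torus-fixed and `G`-moved, no cubic torus eigenvector, torus-blindness pins the type
    obtain ⟨⟨g₀, hg₀⟩, hvan⟩ := hVAN V hS N D M C q X W₁ Q hq R hN hDMC hq3 hq3N hc hQ h2
    refine hCU q h2 R.η R.η_irred (R.spanG (R.dockNonsplit hq Q.form)) ρ hirrW ?_ ?_ ?_
    · refine ⟨⟨R.dockNonsplit hq Q.form, huC⟩, fun h => dockNonsplit_form_ne_zero Q hq R (Submodule.coe_eq_zero.mpr h),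
        fun t ht => Subtype.ext ?_⟩
      rw [hρ]
      exact R.indRep_dockNonsplit_of_mem_torus hq Q.form ht
    · refine ⟨g₀, ⟨R.dockNonsplit hq Q.form, huC⟩, fun h => hg₀ ?_⟩
      have h' := congrArg Subtype.val h
      rw [hρ] at h'
      exact h'
    · intro ν w hν hw
      have hw0 : (w : R.IndCuspForm) = 0 :=
        hvan ν w w.2 hν (fun t ht => by
          have h' := congrArg Subtype.val (hw t ht)
          rw [hρ, Submodule.coe_smul] at h'
          exact h')
      exact Submodule.coe_eq_zero.mp hw0


/-- **THE NODE'S FULL CUT: (L1S) ∧ (SPH) ∧ (BCV) ∧ (VAN) ∧ ((FGT-PS) ∧ (FGT-C)) ⟹ (ISO)♮** (real proof: the one-sided cut, then the type cut). -/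
theorem coverIsotypicComponent_of_lines (hL1S : SplitFixedRankOne) (hSPH : SphericalTransfer) (hBCV : BorelCubicEigenDocking)
    (hVAN : NonsplitTorusCubicVanishing) (hFGT : CubicPrincipalSeriesCharacter ∧ CubicCuspidalCharacter) : CartanNatural.CoverIsotypicComponent :=
  coverIsotypicComponent_of (coverIsotypicIrreducible_of hL1S hSPH) hBCV hFGT.1 hVAN hFGT.2

/-- **THIS NODE'S FULL CUT: (L1S) ∧ (BCV) ∧ (VAN) ∧ ((FGT-PS) ∧ (FGT-C)) ⟹ (ISO)♮** — four hypotheses; (SPH) is the theorem of §A (real proof). -/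
theorem coverIsotypicComponent_of_lines' (hL1S : SplitFixedRankOne) (hBCV : BorelCubicEigenDocking)
    (hVAN : NonsplitTorusCubicVanishing) (hFGT : CubicPrincipalSeriesCharacter ∧ CubicCuspidalCharacter) : CartanNatural.CoverIsotypicComponent :=
  coverIsotypicComponent_of_lines hL1S sphericalTransfer hBCV hVAN hFGT

end Summit.BirchSwinnertonDyer.BirchSwinnertonDyer.Theorems.CartanDoubleCoset

end
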